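import Summits.BirchSwinnertonDyer.Rank1Residual.X10.CoreTheoremAOddPrimeHolds
import Summits.BirchSwinnertonDyer.Rank1Residual.SmallImageMu.MuDefectLeFineMuEdges
import Summits.BirchSwinnertonDyer.BirchSwinnertonDyer.Theses.OneSidedTwistSqueezeX9
import Summits.BirchSwinnertonDyer.BirchSwinnertonDyer.Theses.SmallImageMuTransfer
import HarnessLib

set_option autoImplicit false

-- the summit and its single problem are both named `BirchSwinnertonDyer` (registry layout D-0017)
set_option linter.dupNamespace false

/-!
# Crux 20547 ⟸ crux 19630 ∧ F1, in the kernel: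
# `F1_ζ → Theses.SmallImageMuTransfer.AnalyticMuZeroX9 → Theses.OneSidedTwistSqueezeX9.KatoDivisibilityX9`

Cell `bsd-f3-mu`, seat `bsd-f3-mu-p1` (lead prover, gen 4), director-bsd W-58 (iv) (2026-08-27T22:57:12Z),
`--supports stmt-BirchSwinnertonDyer-20547`.  Tree imports only; no new named fact; nothing asserted beyond the
theorems; 0 sorry.  SIBLING of `Theorems/OneSidedTwistSqueezeX9KatoDivisibilityX9OfAnalyticMuZeroX9.lean` (ES lens,
p583091: the same implication modulo {F1_ζ, modularity} and modulo {F1_ζ, BCS 2025 (a)}); THIS file removes the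
third binder — F1_ζ ALONE — on the scope `p ≠ 2`, good ordinary, `E[p]` irreducible, `ρ̄_{E,p}` NOT surjective
(every X9 and X10b pair), by going through the finiteness of `Sel₀[p]` directly rather than through `μ(X) = 0`.

WHAT IS PROVED.  Write F1_ζ for the PUBLISHED construction fact
`Kato2004.exists_divisibilityInputs_fineQuotient_zeta` (Kato 2004 Thm. 12.6 with Ex. 13.3, (14.9.3), (17.13.1): the
§17.13 package on `(𝐇¹_Γ(T_pE), X(E/ℚ_∞))` with its exact fine quotient `X ↠ X₀` and the zeta module inside the span
of genuine `Λ`-adic Euler-system classes).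

* §1 (per pair, per cyclotomic datum; `p ≠ 2` good ordinary, `E[p]` irreducible, `ρ̄_{E,p}` NOT surjective).
  ONE newform `f` of `E` with ONE `p`-adic unit among the coefficients of `L_p(f, α)` and F1_ζ make
  `Sel₀(ℚ_∞, E[p^∞])[p]` finite (`finite_fineSelmerInfty_pTorsion_of_cert_of_fine`).  Chain (all tree theorems):
  Greenberg–Vatsal Prop. 3.7 (`L_p = ι G₁`, `G₁ ∈ Λ`) and the unit coefficient give `G₁ ∉ (p)`; Kato's package then
  contains a GENUINE Euler-system class outside `p𝐇¹` (`Kato2004.exists_isEulerSystemClass_not_mem`, §6 (i) of the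
  cell `bsd-smallim`'s μ-transfer with the Thm. 12.6 span clause); the kernel-proved core of Theorem A at every odd
  prime (`X10.coreTheoremAOddPrime_holds`) turns that class into a power of `T` killing the `E[p]`-lifts of `Sel₀`,
  whence finiteness (`finite_fineSelmerInfty_pTorsion_of_forall_iterate_eq_zero`).
* §2 (per pair).  Hence Coates–Sujatha's (A) at the pair (`conjAAt_of_cert_of_fine`, transport of the finiteness
  along `ker κ₀ = ker κ` between cyclotomic data, as in `SmallImageMu.conjAOnClassX9_of_eulerPrimitiveOnClassX9`),
  fine `μ = 0` at the pair (`X₀/(p)` finite ⟹ `ℓ_(p)(X₀) = 0`), and — the point of this file — KATO'S INTEGRAL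
  ONE-SIDED DIVISIBILITY at the pair (`katoDivisibilityAt_of_muAnZeroAt_of_fine : F1_ζ → … → MuAnZeroAt W p →
  KatoDivisibilityAt W p`): for the data `(κ, γ, f, D)` of the carrier the newform is GIVEN, so NO modularity supply
  is needed; fine `μ = 0` feeds the landed BCS-free edge `SmallImageMu.katoDivisibilityAt_of_fineMuZeroAt_F1`
  (Kato's Thm. 17.4 (3) argument with the `(p)`-part input replaced, ES lens p571056), which puts `G₁`
  (`ι G₁ = L_p`, GV Prop. 3.7) in `char_Λ X(E/ℚ_∞)`.
* §3 (class X9).  `katoDivisibilityOnClassX9_of_analyticMuZeroOnClassX9_of_fine` (tree vocabulary) and the route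
  spelling asked for by the director,
  `katoDivisibilityX9_of_analyticMuZeroX9_of_fine : F1_ζ → Theses.SmallImageMuTransfer.AnalyticMuZeroX9 →
  Theses.OneSidedTwistSqueezeX9.KatoDivisibilityX9` (both route decls are the tree nodes by `rfl`).  Also LINE A's
  open stub in these terms: `conjAOnClassX9_of_analyticMuZeroOnClassX9_of_fine` (modulo a modular-parametrisation
  supply `hmodP`, since `ConjAOnClassX9` carries no newform); the `μ^alg`-reading of the same input is already the
  tree's `X10.mu_eq_zero_of_fine` (the `μ`-transfer modulo F1_ζ at every odd prime) and is not repeated.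

READING (D-0146 map of the cell): crux 20547 (`KatoDivisibilityX9`, route `OneSidedTwistSqueezeX9`) follows from
crux 19630 (`AnalyticMuZeroX9`, route `SmallImageMuTransfer`) and the ONE printed construction fact F1_ζ; so route
`OneSidedTwistSqueezeX9`'s independent content is exactly «(K) on X9 by roads weaker than `μ^an = 0`» (statement (A)
per pair: FMW / first-layer / doors).  Nothing here decides 19630 (X9: 790 = 130 5Ns + 36 7Ns + 624 5S4 pairs, open);
beyond-print theorem: NO (conditional composition).  BSD is not proved by any of this.

References: K. Kato, Astérisque 295 (2004), Thm. 12.6 (p. 222), Ex. 13.3 (p. 225), §13.8, (14.9.3) (p. 240),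
Thm. 17.4 (p. 273), §17.13 (pp. 279–280) [Kato2004Asterisque]; R. Greenberg, V. Vatsal, Invent. Math. 142 (2000),
Prop. 3.7 [GreenbergVatsal2000]; J. Coates, R. Sujatha, Math. Ann. 331 (2005), §3 [CoatesSujatha2005];
R. Greenberg, LNM 1716 (1999), §1 Conj. 1.11 [GreenbergLNM1716]; C. Wuthrich, JAG 16 (2007), Thm. 2 [Wuthrich2006].
-/

noncomputable section

open scoped Classical MatrixGroups ModularForm NumberField
open CongruenceSubgroup WeierstrassCurve Field
open Literature.NumberTheory.GaloisRepresentations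
open Literature.NumberTheory.EllipticCurves Literature.NumberTheory.EllipticCurves.ModularForms
open Literature.NumberTheory.EllipticCurves.Kato2004
open Literature.NumberTheory.EllipticCurves.Kato2004.EulerSystemValues
open Literature.NumberTheory.EllipticCurves.IwasawaDual
open Literature.NumberTheory.EllipticCurves.Rank1Residual (MuAnZeroAt FineMuZeroAt KatoDivisibilityAt ConjAAt)
open Summit.BirchSwinnertonDyer.BirchSwinnertonDyer.Rank1Residual (ClassX9 AnalyticMuZeroOnClassX9)
open Summit.BirchSwinnertonDyer.Rank1Residual.SmallImageMu (KatoDivisibilityOnClassX9 ConjAOnClassX9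
  katoDivisibilityAt_of_fineMuZeroAt_F1 katoDivisibilityOnClassX9_of_conjAOnClassX9_F1 fineQuotient_of_zeta)
open Summit.BirchSwinnertonDyer.Rank1Residual.X10 (coreTheoremAOddPrime_holds)
open Module IwasawaAlgebra

namespace Summit.BirchSwinnertonDyer.BirchSwinnertonDyer.Theorems.OneSidedTwistSqueezeX9KatoDivisibilityX9OfAnalyticMuZeroX9FineAlone

/-! ## §1 Per pair and cyclotomic datum: one unit coefficient ∧ F1_ζ ⟹ `Sel₀(ℚ_∞, E[p^∞])[p]` finite -/

section PerPair

variable {p : ℕ} [Fact p.Prime] {W : WeierstrassCurve ℚ} [W.IsElliptic] [W.IsGloballyMinimal]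

/-- **`Sel₀(ℚ_∞, E[p^∞])[p]` is finite** at a prime `p ≠ 2` of good ordinary reduction with `E[p]` irreducible and
`ρ̄_{E,p}` not surjective, over a cyclotomic datum `(κ, γ)` matching the cyclotomic variable, as soon as ONE newform
`f` of `E` has ONE `p`-adic unit coefficient in `L_p(f, α)` — modulo Kato's construction fact F1_ζ alone.
GV Prop. 3.7 + the certificate ⟹ `G₁ ∉ (p)`; F1_ζ's package ⟹ a genuine Euler-system class `∉ p𝐇¹`
(`exists_isEulerSystemClass_not_mem`); the kernel core `X10.coreTheoremAOddPrime_holds` ⟹ a power of `T` kills the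
`E[p]`-lifts of `Sel₀`; `finite_fineSelmerInfty_pTorsion_of_forall_iterate_eq_zero`.
[cite: Kato2004Asterisque, Thm. 12.6 (p. 222), §13.8 (p. 228), (14.9.3) (p. 240), §17.13 (pp. 279–280)]
[cite: GreenbergVatsal2000, Prop. 3.7] -/
theorem finite_fineSelmerInfty_pTorsion_of_cert_of_fine
    (hfine : exists_divisibilityInputs_fineQuotient_zeta) (hp2 : p ≠ 2)
    (hgood : W.HasGoodReductionAtPrime p) (hap : ¬ (p : ℤ) ∣ W.frobeniusTrace p)
    (hirr : W.HasIrreducibleModPGaloisRep p) (hns : ¬ W.HasSurjectiveModNGaloisRep p)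
    {N : ℕ} [NeZero N] {f : CuspForm (Gamma0 N) 2} (hf : IsNewformOf W f)
    (hcert : ∃ n : ℕ, ‖PowerSeries.coeff n (padicLFunction f (unitRoot W p : ℚ_[p]))‖ = 1)
    (κ : ZpExtension ℚ p) {γ : absoluteGaloisGroup ℚ} (hκ : κ.IsCyclotomic) (hγ : κ.IsTopGenerator γ)
    (hγ' : IsCyclotomicVariable p γ) :
    Set.Finite {s : W.fineSelmerInfty κ | p • s = 0} := by
  haveI : ContinuousSMul ℤ_[p] (W.tateModule p) := TateModule.continuousSMul_padicInt
  haveI : Module.Free ℤ_[p] (W.tateModule p) := W.module_free_tateModule_holds p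
  haveI : Module.Finite ℤ_[p] (W.tateModule p) := W.module_finite_tateModule_holds p
  have hord : IsOrdinaryAt W p := ⟨hgood, hap⟩
  -- the pinned modules: Kato's `𝐇¹_Γ(T_pW)`, the dual Selmer group and the dual fine Selmer group over `(κ, γ)`
  obtain ⟨I⟩ := Kato2004.nonempty_iwasawaH1Data_holds W p κ γ hκ hγ
  let D : W.SelmerDualData κ γ := W.selmerDualData κ hγ
  let Y : W.FineSelmerDualData κ γ := W.fineSelmerDualData κ hγ
  -- Kato's package with the fine quotient and the Thm. 12.6 span clause
  obtain ⟨K, π, -, -, hZ⟩ := hfine W p f κ γ hp2 hord hκ hγ hγ' hf I D Y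
  -- `L_p ∈ Λ` (GV Prop. 3.7) and the certificate: `G₁ ∉ (p)`
  obtain ⟨G₁, hG₁⟩ := exists_iwasawaToPowerSeries_eq_padicLFunction hp2 hord hf hirr
  have hμL : G₁ ∉ augIdealP p := not_mem_augIdealP_of_norm_coeff_eq_one hG₁ hcert
  -- some GENUINE Euler-system class is not divisible by `p`
  obtain ⟨s, hs, hsp⟩ := exists_isEulerSystemClass_not_mem K hZ hirr hG₁ hμL
  -- the kernel core (every odd prime): a power of `T` kills the `E[p]`-lifts of `Sel₀`
  obtain ⟨J, hJ⟩ := coreTheoremAOddPrime_holds W p κ γ I hp2 hgood hap hirr hns hκ hγ ⟨s, hs, hsp⟩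
  exact W.finite_fineSelmerInfty_pTorsion_of_forall_iterate_eq_zero κ hγ hJ

omit [W.IsElliptic] [W.IsGloballyMinimal] in
/-- **Transport of the finiteness of `Sel₀[p]` between cyclotomic data**: `Sel₀(K_∞, E[p^∞])` only sees the fixed
field of `ker κ`, and all cyclotomic `κ` share it (`ZpExtension.IsCyclotomic.kerSubgroup_eq`).  (The `subst` trick
of `SmallImageMu.conjAOnClassX9_of_eulerPrimitiveOnClassX9`.) [folklore] -/
theorem finite_fineSelmerInfty_pTorsion_of_isCyclotomic {κ₀ κ : ZpExtension ℚ p} (hκ₀ : κ₀.IsCyclotomic)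
    (hκ : κ.IsCyclotomic) (h0 : Set.Finite {s : W.fineSelmerInfty κ₀ | p • s = 0}) :
    Set.Finite {s : W.fineSelmerInfty κ | p • s = 0} := by
  have hker : κ₀.kerSubgroup = κ.kerSubgroup := ZpExtension.IsCyclotomic.kerSubgroup_eq hκ₀ hκ
  have aux : ∀ {H₀ H : Subgroup (absoluteGaloisGroup ℚ)} [H₀.Normal] [H.Normal], H₀ = H →
      Set.Finite {s : GreenbergSelmer.strictSelmerGroupOver H₀ (W.geomPrimaryTorsion p) p
        (GreenbergSelmer.fineData (W.geomPrimaryTorsion p) p) | p • s = 0} →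
      Set.Finite {s : GreenbergSelmer.strictSelmerGroupOver H (W.geomPrimaryTorsion p) p
        (GreenbergSelmer.fineData (W.geomPrimaryTorsion p) p) | p • s = 0} := by
    intro H₀ H _ _ hH hf
    subst hH
    exact hf
  exact aux hker h0

/-- **At the NORMALISED cyclotomic datum**: under the hypotheses of §1 (with the certificate for ONE newform),
`Sel₀(ℚ_∞, E[p^∞])[p]` is finite for EVERY cyclotomic `κ` (the normalised `(κ₀, γ₀)` of
`exists_isCyclotomic_isTopGenerator_isCyclotomicVariable_holds` feeds §1, then transport).
[cite: Kato2004Asterisque, Thm. 12.6 (p. 222) and §17.13 (pp. 279–280)] [cite: Washington1997, §13.1] -/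
theorem finite_fineSelmerInfty_pTorsion_of_cert_of_fine'
    (hfine : exists_divisibilityInputs_fineQuotient_zeta) (hp2 : p ≠ 2)
    (hgood : W.HasGoodReductionAtPrime p) (hap : ¬ (p : ℤ) ∣ W.frobeniusTrace p)
    (hirr : W.HasIrreducibleModPGaloisRep p) (hns : ¬ W.HasSurjectiveModNGaloisRep p)
    {N : ℕ} [NeZero N] {f : CuspForm (Gamma0 N) 2} (hf : IsNewformOf W f)
    (hcert : ∃ n : ℕ, ‖PowerSeries.coeff n (padicLFunction f (unitRoot W p : ℚ_[p]))‖ = 1)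
    (κ : ZpExtension ℚ p) (hκ : κ.IsCyclotomic) :
    Set.Finite {s : W.fineSelmerInfty κ | p • s = 0} := by
  obtain ⟨κ₀, hκ₀, γ₀, hγ₀, hγ₀c⟩ := exists_isCyclotomic_isTopGenerator_isCyclotomicVariable_holds p
  exact finite_fineSelmerInfty_pTorsion_of_isCyclotomic hκ₀ hκ
    (finite_fineSelmerInfty_pTorsion_of_cert_of_fine hfine hp2 hgood hap hirr hns hf hcert κ₀ hκ₀ hγ₀ hγ₀c)

/-! ## §2 Per pair: statement (A), fine `μ = 0`, and Kato's INTEGRAL divisibility -/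

/-- **Coates–Sujatha's (A) at the pair from ONE certified newform, modulo F1_ζ** (`p ≠ 2` good ordinary, `E[p]`
irreducible, `ρ̄` not surjective): `Sel₀[p]` finite over every cyclotomic `κ` (§1) ⟹ its dual is finitely generated
over `ℤ_p` (`FineSelmerLeSignedSelmer.conjA_of_finite_fineSelmerInfty_pTorsion`, unconditional).
[cite: CoatesSujatha2005, §3 (Conjecture A and Lemma 3.1)] [cite: Kato2004Asterisque, Thm. 12.6 (p. 222), §17.13] -/
theorem conjAAt_of_cert_of_fine
    (hfine : exists_divisibilityInputs_fineQuotient_zeta) (hp2 : p ≠ 2)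
    (hgood : W.HasGoodReductionAtPrime p) (hap : ¬ (p : ℤ) ∣ W.frobeniusTrace p)
    (hirr : W.HasIrreducibleModPGaloisRep p) (hns : ¬ W.HasSurjectiveModNGaloisRep p)
    {N : ℕ} [NeZero N] {f : CuspForm (Gamma0 N) 2} (hf : IsNewformOf W f)
    (hcert : ∃ n : ℕ, ‖PowerSeries.coeff n (padicLFunction f (unitRoot W p : ℚ_[p]))‖ = 1) :
    ConjAAt W p := by
  intro κ hκ
  obtain ⟨γ, hγ⟩ : ∃ γ : absoluteGaloisGroup ℚ, κ.IsTopGenerator γ := κ.surjective (Multiplicative.ofAdd 1)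
  exact Summit.BirchSwinnertonDyer.BirchSwinnertonDyer.Theorems.FineSelmerLeSignedSelmer.conjA_of_finite_fineSelmerInfty_pTorsion
    W κ hγ (finite_fineSelmerInfty_pTorsion_of_cert_of_fine' hfine hp2 hgood hap hirr hns hf hcert κ hκ)

/-- **Fine `μ = 0` at the pair from ONE certified newform, modulo F1_ζ**: over every cyclotomic datum every finitely
generated torsion dual fine datum `Y` has `μ(Y.X) = 0` (`Sel₀[p]` finite ⟹ `Y.X/(p)` finite ⟹ `ℓ_(p)(Y.X) = 0`).
[cite: Kato2004Asterisque, §13.8 (p. 228) and §17.13 (pp. 279–280)] [cite: GreenbergLNM1716, §1 p. 60] -/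
theorem fineMuZeroAt_of_cert_of_fine
    (hfine : exists_divisibilityInputs_fineQuotient_zeta) (hp2 : p ≠ 2)
    (hgood : W.HasGoodReductionAtPrime p) (hap : ¬ (p : ℤ) ∣ W.frobeniusTrace p)
    (hirr : W.HasIrreducibleModPGaloisRep p) (hns : ¬ W.HasSurjectiveModNGaloisRep p)
    {N : ℕ} [NeZero N] {f : CuspForm (Gamma0 N) 2} (hf : IsNewformOf W f)
    (hcert : ∃ n : ℕ, ‖PowerSeries.coeff n (padicLFunction f (unitRoot W p : ℚ_[p]))‖ = 1) :
    FineMuZeroAt W p := by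
  intro κ γ hκ hγ _hγ' Y hYf _hYt
  haveI := hYf
  haveI : Finite (Y.X ⧸ (augIdealP p • (⊤ : Submodule (IwasawaAlgebra p) Y.X))) :=
    Y.finite_quotient_augIdealP_of_finite_pTorsion
      (finite_fineSelmerInfty_pTorsion_of_cert_of_fine' hfine hp2 hgood hap hirr hns hf hcert κ hκ)
  let 𝔭 : PrimeSpectrum (IwasawaAlgebra p) := ⟨augIdealP p, isPrime_augIdealP_holds p⟩
  have hY0 : lengthAt (IwasawaAlgebra p) Y.X 𝔭 = 0 :=
    Summit.BirchSwinnertonDyer.BirchSwinnertonDyer.Rank1Residual.KatoMuSkeleton.lengthAt_eq_zero_of_finite_quotient_p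
      (M := Y.X) 𝔭 rfl
  rw [muInvariant_eq_toNat_lengthAt p Y.X 𝔭 rfl, hY0]
  rfl

/-- **Kato's INTEGRAL one-sided divisibility at the pair from `μ^an = 0` at the pair, modulo F1_ζ ALONE**
(`p ≠ 2` good ordinary, `E[p]` irreducible, `ρ̄_{E,p}` not surjective — every X9 and X10b pair): for all cyclotomic
data, every newform `f` and every dual Selmer datum `D`, `∃ g ∈ char_Λ X(E/ℚ_∞), ι g = L_p(f, α)`.  The newform is
GIVEN by the statement, so no modularity supply enters: `MuAnZeroAt` certifies THAT `f`, which gives fine `μ = 0`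
at the pair (`fineMuZeroAt_of_cert_of_fine`), and the landed BCS-free edge
`SmallImageMu.katoDivisibilityAt_of_fineMuZeroAt_F1` (Kato's Thm. 17.4 (3) argument with the `(p)`-part input
replaced — `ℓ_(p)(X₀) = 0` for the package's fine quotient, off `(p)` the image-free Euler-system bound — and
GV Prop. 3.7 `ι G₁ = L_p`) puts `G₁` in `char X`; F1_ζ ⟹ F1 by `SmallImageMu.fineQuotient_of_zeta`.
[cite: Kato2004Asterisque, Thm. 12.6 (p. 222), Thm. 17.4 (p. 273), §17.13 (pp. 279–280)]
[cite: GreenbergVatsal2000, Prop. 3.7] [cite: Washington1997, §13.2] -/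
theorem katoDivisibilityAt_of_muAnZeroAt_of_fine
    (hfine : exists_divisibilityInputs_fineQuotient_zeta) (hp2 : p ≠ 2)
    (hgood : W.HasGoodReductionAtPrime p) (hap : ¬ (p : ℤ) ∣ W.frobeniusTrace p)
    (hirr : W.HasIrreducibleModPGaloisRep p) (hns : ¬ W.HasSurjectiveModNGaloisRep p)
    (hμ : MuAnZeroAt W p) : KatoDivisibilityAt W p := by
  intro κ γ N _ f hκ hγ hγ' hf D
  -- fine `μ = 0` at the pair, certified by THIS newform (§1–§2), then the landed F1 edge
  exact katoDivisibilityAt_of_fineMuZeroAt_F1 (fineQuotient_of_zeta hfine) hp2 ⟨hgood, hap⟩ hirr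
    (fineMuZeroAt_of_cert_of_fine hfine hp2 hgood hap hirr hns hf (hμ f hf)) κ γ f hκ hγ hγ' hf D

end PerPair

/-! ## §3 Class X9: crux 20547 from crux 19630 and F1_ζ -/

/-- **Tree vocabulary: F1_ζ ∧ `AnalyticMuZeroOnClassX9` ⟹ `SmallImageMu.KatoDivisibilityOnClassX9`** (on X9,
`ClassX9 W p` gives `5 ≤ p ≠ 2`, good ordinary, `Irr`, `¬Surj`; the newform is the target's own binder).
[cite: Kato2004Asterisque, Thm. 12.6 (p. 222), Thm. 17.4 (p. 273), §17.13 (pp. 279–280)] [cite: GreenbergVatsal2000, Prop. 3.7] -/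
theorem katoDivisibilityOnClassX9_of_analyticMuZeroOnClassX9_of_fine
    (hfine : exists_divisibilityInputs_fineQuotient_zeta) (hA : AnalyticMuZeroOnClassX9) :
    KatoDivisibilityOnClassX9 := by
  intro W _ _ p _ κ γ N _ f hX9 hκ hγ hγ' hf D
  obtain ⟨-, hp5, hgood, hap, hirr, hns⟩ := id hX9
  exact katoDivisibilityAt_of_muAnZeroAt_of_fine hfine (by omega) hgood hap hirr hns
    (fun g hg ↦ hA W p g hX9 hg) κ γ f hκ hγ hγ' hf D

/-- The route decls ARE the tree nodes. -/
example : Theses.OneSidedTwistSqueezeX9.KatoDivisibilityX9 = KatoDivisibilityOnClassX9 := rfl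

/-- The route decls ARE the tree nodes. -/
example : Theses.SmallImageMuTransfer.AnalyticMuZeroX9 = AnalyticMuZeroOnClassX9 := rfl

/-- **Director-bsd W-58 (iv), the route spelling: crux 20547 ⟸ crux 19630 ∧ F1_ζ** —
`F1_ζ → Theses.SmallImageMuTransfer.AnalyticMuZeroX9 → Theses.OneSidedTwistSqueezeX9.KatoDivisibilityX9`.
One-sided τ-free INTEGRAL Kato divisibility on class X9 follows from analytic `μ = 0` on X9 (Greenberg's
Conj. 1.11, analytic side — OPEN, item 19630) and Kato's printed construction fact; nothing else.
[cite: Kato2004Asterisque, Thm. 12.6 (p. 222), Thm. 17.4 (p. 273), §17.13 (pp. 279–280)]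
[cite: GreenbergVatsal2000, Prop. 3.7] [cite: GreenbergLNM1716, §1 Conj. 1.11] -/
theorem katoDivisibilityX9_of_analyticMuZeroX9_of_fine (hfine : exists_divisibilityInputs_fineQuotient_zeta)
    (hA : Theses.SmallImageMuTransfer.AnalyticMuZeroX9) : Theses.OneSidedTwistSqueezeX9.KatoDivisibilityX9 :=
  katoDivisibilityOnClassX9_of_analyticMuZeroOnClassX9_of_fine hfine hA

/-- The type of `katoDivisibilityX9_of_analyticMuZeroX9_of_fine` is LITERALLY the director's arrow spelling. -/
example : exists_divisibilityInputs_fineQuotient_zeta → Theses.SmallImageMuTransfer.AnalyticMuZeroX9 →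
    Theses.OneSidedTwistSqueezeX9.KatoDivisibilityX9 :=
  katoDivisibilityX9_of_analyticMuZeroX9_of_fine

/-- **LINE A's open stub in these terms**: F1_ζ ∧ `AnalyticMuZeroOnClassX9` ∧ a modular-parametrisation supply
(`hmodP`, to produce a newform — `ConjAOnClassX9` has no newform binder) ⟹ `SmallImageMu.ConjAOnClassX9`
(Coates–Sujatha's (A) on every X9 pair). [cite: CoatesSujatha2005, §3 (Conjecture A and Lemma 3.1)]
[cite: Kato2004Asterisque, Thm. 12.6 (p. 222) and §17.13 (pp. 279–280)] -/
theorem conjAOnClassX9_of_analyticMuZeroOnClassX9_of_fine (hmodP : nonempty_modularParametrizationData)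
    (hfine : exists_divisibilityInputs_fineQuotient_zeta) (hA : AnalyticMuZeroOnClassX9) :
    ConjAOnClassX9 := by
  intro W _ _ p _ hX9
  obtain ⟨-, hp5, hgood, hap, hirr, hns⟩ := id hX9
  haveI : NeZero (W.conductorNorm ℤ) := ⟨(W.conductorNorm_pos_holds).ne'⟩
  obtain ⟨Dm⟩ := hmodP W
  exact conjAAt_of_cert_of_fine hfine (by omega) hgood hap hirr hns Dm.isNewformOf
    (hA W p Dm.f hX9 Dm.isNewformOf)

/-- **The composite with LINE A's landed stub 2** (`OneSidedTwistSqueezeX9KatoDivisibilityX9Stubs.stub_wuthrichUpgradeX9`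
road, here through `SmallImageMu.katoDivisibilityOnClassX9_of_conjAOnClassX9_F1` and `fineQuotient_of_zeta`): the same
conclusion as `katoDivisibilityX9_of_analyticMuZeroX9_of_fine`, but paying a modular-parametrisation supply for the
detour through (A) — recorded to show the two roads agree; the direct road above is the one of record.
[cite: Kato2004Asterisque, Thm. 17.4 (p. 273), §17.13 (pp. 279–280)] [cite: Wuthrich2006, Thm. 2 / Lemma 3] -/
theorem katoDivisibilityX9_of_analyticMuZeroX9_of_fine_via_conjA (hmodP : nonempty_modularParametrizationData)
    (hfine : exists_divisibilityInputs_fineQuotient_zeta) (hA : Theses.SmallImageMuTransfer.AnalyticMuZeroX9) :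
    Theses.OneSidedTwistSqueezeX9.KatoDivisibilityX9 :=
  katoDivisibilityOnClassX9_of_conjAOnClassX9_F1 (fineQuotient_of_zeta hfine)
    (conjAOnClassX9_of_analyticMuZeroOnClassX9_of_fine hmodP hfine hA)

end Summit.BirchSwinnertonDyer.BirchSwinnertonDyer.Theorems.OneSidedTwistSqueezeX9KatoDivisibilityX9OfAnalyticMuZeroX9FineAlone

end
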